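import Summits.ABC.IUTFork.Joshi.ATS4GenuineResidualSUnitFibresSeven
import Summits.ABC.IUTFork.Joshi.ATS4DescentSpineGenuineResidualUnsat
import HarnessLib

/-!
# [J-IV] (arXiv:2403.10430v2) §6.10–§7.1, E5 descent spine: the GENUINE-COMPONENT residual at the RIGHT EDGE `ℓ = 5`
# (R-J row Y-21 PARENT, rider (r4); E ROW R-27) — the `∃`-body is UNSATISFIABLE at `P_{a,c}`, `d = 2`, `ℓ = 5`, via the prime `p₀ = 7`

Proof-only companion (0 defs) of the abc-iut cell, sub-cell R-J «JOSHI Y-DISCHARGE CENSUS» (rung LADDER-ABC:A2.RESCUE.J; table of record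
`HOME/plan/E/R-J/Y-CENSUS.tsv`, row Y-21 PARENT), seat abc-iut-E-t35 (gen 12), E ROW R-27 (`HOME/plan/E/R-J/E-ROWS.md` §E, WAKE
`HOME/abc-iut-E-t35/WAKE-R-27.md`): the census word v1.36 reads «UNSATISFIABLE AT THE WITNESS FAMILY of S-unit points `P_{a,c}` (`a ≥ 10⁸`,
`c ≥ 1`, `7^c ≤ 5^a`), `p₀ = 5`, `d = 2`, EVERY prime `ℓ ≥ 7`» (this seat's gen-9 `SUnitResidual.genuineResidualSupport_unsat`, p480406) with
rider (r4) «every prime `ℓ ≥ 7` is the right edge». THE DECL CHECK behind the edge (R-27 (1)):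

* `ℓ = 5` IS admissible for BOTH typed initial-Θ-data structures: [IUTchI] Def. 3.1 (c) «`l ≥ 5`» =
  `Literature.IUT.HodgeTheaters.InitialThetaData.five_le_l : 5 ≤ l`, and [J-III] §3.3 (11) «`ℓ ≥ 5`» =
  `Summit.ABC.IUTFork.Joshi.ATS3.InitialThetaData.five_le : 5 ≤ ℓ` (reader's checks at the end of this file);
* but NOT for the E5 binder: the hypothesis `H` of `abc_of_genuineResidualSupport` (p464392 §4) quantifies `∀ ℓ, ℓ.Prime → 5 ≤ ℓ →
  IsLem587Prime d P ℓ → ITDConditions P ℓ → …` and `ATS4.ITDConditions P ℓ := 7 ≤ ℓ ∧ CondP2 ∧ CondP5 ∧ CondP6` (OUR READING of the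
  «Completion of the Proof of Theorem 5.7.1», p.57 l.17–26: `ℓ ≠ 5` because `C_λ[5] ⊆ C_λ(L)` kills (12) at `ℓ = 5`; the tree's (P7)
  constructor takes `7 ≤ l`) — so EVERY `ℓ = 5` INSTANCE OF `H` IS VACUOUS (`not_itdConditions_five`, `antecedent_instance_at_five`): in the
  binder's own sense the `d = 2` word already covers every admissible prime.

So that NO reading of «admissible» is left open, THIS FILE also covers the `∃`-BODY at `ℓ = 5` (R-27 (2), `d = 2`): at `ℓ = 5` the set
`S = {2, ℓ}` swallows the pole `𝔭₁ ∣ 5`, so `log 𝔮_F = log q^{∤{2,5}}(λ_{a,c}) = 2c·log 7` EXACTLY and ALL the `q`-mass sits at `p₀ = 7`,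
where BOTH places `𝔮₁, 𝔮₂ ∣ 7` of `F_{a,c}` are poles of order `2c`: `q₇ = 2c·log 7`, `d₇ ≤ log 7` on the whole `5`-division tower
(`F_{a,c}` SPLIT at `7`, `7 ∤ 46080`, top layer tame above `7 ≠ 5` by the tree's `ThetaTower.hKtame`), `7 ∈ V^dst_ℚ` forced — companion
`ATS4GenuineResidualSUnitFibresSeven` (`SUnitResidual.logQAvoid_two_five_eq` / `qSeven_eq` / `dSeven_le` / `exists_mem_V_residueChar_eq_seven`,
the `p₀ = 7` twin of p479649). The local excess at `7`
beats the global cap `(1/10)·log 𝔮_F` as soon as `c ≥ 10⁷` (`localExcess_arith_five`: ratio `Q/q₇ = 1 < ℓ(ℓ+1)/12 = 5/2`; linear in `c`,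
`c_fail ≈ 5.27·10⁶`), and E-t50's `not_exists_volumes_of_localExcess` (p470440) leaves NO `(vol, vol_∞)`:

* **`SUnitResidual.genuineResidualSupport_unsat_five`** — the `∃`-body of p464392 §4 VERBATIM (byte-identical to the body negated in
  p480406) at `d := 2`, `P := Pt a c` (`a ≥ 1`, `c ≥ 10⁷`; NO relation between `a` and `c` needed), `ℓ = 5`: FALSE;
* **`SUnitResidual.genuineResidualSupport_unsat_of_five_le`** — with p480406: at `P_{a,c}` (`a ≥ 10⁸`, `c ≥ 10⁷`, `7^c ≤ 5^a`), `d = 2`,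
  the body is FALSE for EVERY prime `ℓ ≥ 5` = every `ℓ` the two `InitialThetaData` structures admit. The right edge (r4) thus reads
  «every admissible prime `ℓ`» under either reading (binder: vacuous below `7`; structures: covered at `5`).

Not covered here (R-27 (2), `d = 1`): the `ℚ`-family edge `ℓ ∈ {5, 7}` is the sequel file's business (`p₀ = 11`); at `ℓ = 5` a `K_V`-bounded
`ℚ`-family has `p₀`-share `≤ 1/3 + o(1)` of `log 𝔮_F` (`u`, `v − u`, `v` pairwise coprime and comparable), below the `12/30` the one-prime
mechanism needs — located there, binder-vacuous anyway. SOURCE locators: [J-IV] Prop. 6.10.9 p.69 l.1–28, (6.11.1) p.69 l.73–p.70 l.3, p.70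
l.4–29, Thm. 5.7.1 p.53 l.31–46 with «Completion» p.57 l.17–26 (render `HOME/lit/renders/Joshi-arxiv-2403.10430/`); [J-III] (2111.04890v4) §3.3
(11) p.28; [IUTchI] Def. 3.1 (c) p.61; [IUTchIV] Thm. 1.10 Step (v) p.27–28, Cor. 2.2 (ii) (P5) p.46 (kurims). FRAMING (binding): a located
COUNTERMODEL to the E5 residual AS PRINTED with (6.11.1)'s `Σ|·|` convention, at OUR typed carriers — not to any author's theorem; NO side taken
on [IUTchIII] Cor. 3.12 / [IUTchIV] Thm. 1.10, on Joshi's claims or on Mochizuki's report on them; NOT an abc claim (nothing here proves or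
refutes abc); typed ≠ proved ≠ endorsed. Theorems only; standard axioms; FACT rows none. [claim: Joshi2024ATS4, status: disputed].
-/

noncomputable section

namespace Summit.ABC.IUTFork.Joshi.ATS4

open NumberField IsDedekindDomain Finset
open Literature.IUT.LogVolume Literature.IUT.LogVolume.Cor22
open Literature.NumberTheory.DiophantineGeometry Literature.NumberTheory.DiophantineGeometry.GenEll
open Literature.NumberTheory.EllipticCurves
open Literature.NumberTheory.NumberFields
open Summit.ABC.IUTFork.SUnitFamily
open scoped Classical

/-! ## 0. The decl check: `ℓ = 5` is excluded by the E5 binder's reading predicate `ITDConditions` -/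

/-- The E5 binder's reading predicate forces `ℓ ≥ 7` (first conjunct of `ITDConditions`, OUR READING of [J-IV] p.57 l.17–26).
[claim: Joshi2024ATS4, status: disputed] -/
theorem seven_le_of_itdConditions {P : NFPoint} {ℓ : ℕ} (h : ITDConditions P ℓ) : 7 ≤ ℓ := h.1

/-- **`ℓ = 5` is NOT admissible for the E5 binder**: `ITDConditions P 5` is false for every point `P` (`7 ≤ 5` fails) — although
`ℓ = 5` passes [IUTchI] Def. 3.1 (c) / [J-III] §3.3 (11) «`ℓ ≥ 5`» (`InitialThetaData.five_le_l` / `ATS3.InitialThetaData.five_le`).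
[claim: Joshi2024ATS4, status: disputed] -/
theorem not_itdConditions_five (P : NFPoint) : ¬ ITDConditions P 5 := fun h => absurd h.1 (by norm_num)

/-- Hence EVERY `ℓ = 5` instance of the hypothesis of `abc_of_genuineResidualSupport` holds VACUOUSLY: whatever the conclusion `C`
(there: the `∃`-body), `IsLem587Prime d P 5 → ITDConditions P 5 → C`. [claim: Joshi2024ATS4, status: disputed] -/
theorem antecedent_instance_at_five (d : ℕ) (P : NFPoint) (C : Prop) : IsLem587Prime d P 5 → ITDConditions P 5 → C :=
  fun _ h => absurd h (not_itdConditions_five P)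

namespace SUnitResidual

/-! ## 1. The real arithmetic of the local excess at `p₀ = 7`, `ℓ = 5`, `d = 2` -/

/-- **The local excess at `7` beats the global cap at `ℓ = 5`** (pure real arithmetic, linear in `c`): with `Q ≤ 2c·log 7` (total `log 𝔮_F`
at `S = {2, 5}`), `q ≥ 2c·log 7` (the `7`-component of `log q`), `d ≤ log 7` (the `7`-component of `log 𝔡_K`), `E ≤ 1105920 = 2·2¹²3³5`
(`e*_mod` at `e_mod ≤ d_mod ≤ 2`), `0 ≤ ι ≤ (log 7)/7` (the Mertens weight), and `c ≥ 10⁷`: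
`(1/10)·Q < (6/4)·(q/6 − (9/5)·d − (4/5)·log 7 − (20/3)·E·ι)` — after dividing by `log 7 > 0` this follows from
`c/5 < c/2 − 39/10 − 11059200/7`, i.e. `c > 5 266 298.6`; ratio `Q/q₇ = 1 < ℓ(ℓ+1)/12 = 5/2`. [folklore] -/
theorem localExcess_arith_five {c Q q d E ι : ℝ} (hc : 10 ^ 7 ≤ c) (hQ : Q ≤ 2 * c * Real.log 7) (hq : 2 * c * Real.log 7 ≤ q)
    (hd : d ≤ Real.log 7) (hE : E ≤ 1105920) (hι0 : 0 ≤ ι) (hι : ι ≤ Real.log 7 / 7) :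
    1 / (2 * (5 : ℝ)) * Q < ((5 : ℝ) + 1) / 4 * (1 / 6 * q - (1 + 4 / (5 : ℝ)) * d - 4 / (5 : ℝ) * Real.log 7 - 20 / 3 * E * ι) := by
  have hL : 0 < Real.log 7 := Real.log_pos (by norm_num)
  have hEι : E * ι ≤ 1105920 * (Real.log 7 / 7) := mul_le_mul hE hι hι0 (by norm_num)
  have hcL : 10 ^ 7 * Real.log 7 ≤ c * Real.log 7 := mul_le_mul_of_nonneg_right hc hL.le
  nlinarith

/-! ## 2. THE COUNTERMODEL AT THE EDGE: the genuine-component residual is unsatisfiable at `P_{a,c}`, `d = 2`, `ℓ = 5` -/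

/-- **The GENUINE-COMPONENT residual (R4′) ∧ (R5) of `abc_of_genuineResidualSupport` (p464392 §4) is UNSATISFIABLE at the S-unit point
`P_{a,c}` (`a ≥ 1`, `c ≥ 10⁷`), `d = 2`, `ℓ = 5` (window-free).** The body below is that theorem's `∃`-body VERBATIM at `d := 2`, `P := Pt a c`
(byte-identical to the body negated by p480406's `genuineResidualSupport_unsat` for `ℓ ≥ 7`), under `ℓ = 5`. Whatever theta field `F`,
division tower `K ⊆ F(E_F[5])`, `L_mod` (`e_mod ≤ d_mod ≤ 2`), `V^dst_ℚ` (forced to contain `7`: `exists_mem_V_residueChar_eq_seven`),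
bookkeeping `D_K`, and local hull log-volumes the supplier returns: at `p₀ = 7` the genuine components are `q₇ = 2c·log 7` (`qSeven_eq`) and
`d₇ ≤ log 7` (`dSeven_le`), while `log 𝔮_F = log q^{∤{2,5}}(λ_{a,c}) = 2c·log 7` (Prop. 4.4.4 `logq_ofNFPointOver_eq_logQAvoid`,
`logQAvoid_two_five_eq`: the pole over `5` is swallowed by `S`), so the local excess beats the global cap (`localExcess_arith_five`) and E-t50's
`not_exists_volumes_of_localExcess` (p470440: (6.11.1) sums `|vol_p|`, no other prime absorbs it) leaves NO `(vol, vol_∞)`. NOTE: the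
instance `ℓ = 5` of the binder `H` itself is VACUOUS (`antecedent_instance_at_five`); this theorem is about the `∃`-BODY, for the reading
«admissible = `InitialThetaData.five_le_l`». A located COUNTERMODEL to the E5 residual AS PRINTED with (6.11.1)'s `Σ|·|` convention — not to any
author's theorem; NO side taken on [IUTchIII] Cor. 3.12 / [IUTchIV] Thm. 1.10; NOT an abc claim. [claim: Joshi2024ATS4, status: disputed] -/
theorem genuineResidualSupport_unsat_five {a c : ℕ} (ha : 1 ≤ a) (hc : 10 ^ 7 ≤ c) {ℓ : ℕ} (hℓ5 : ℓ = 5) :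
    ¬ ∃ (F : Type) (_ : Field F) (_ : NumberField F) (_ : Algebra (Pt a c).F F)
          (K : Type) (_ : Field K) (_ : NumberField K) (_ : Algebra F K) (_ : Algebra (Pt a c).F K)
          (_ : IsScalarTower (Pt a c).F F K)
          (_ : IsGalois F K) (ψ : K →ₐ[F] AlgebraicClosure F) (hU : (Pt a c).InU) (_ : IsThetaField (Pt a c) F)
          (_ : letI := thetaCurve_isElliptic hU F
            ((thetaCurve (Pt a c) F).galoisRepTorsion (ℓ : ℤ)).ker ≤ ψ.fieldRange.fixingSubgroup)
          (_ : 0 < (TateDivisorDatum.ofNFPointOver (Pt a c) {2, ℓ} F).logq)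
          (Lmod : Type) (_ : Field Lmod) (_ : NumberField Lmod) (_ : Cor22.dmod (Pt a c) ≤ dMod Lmod) (_ : dMod Lmod ≤ 2)
          (V : Finset ℕ)
          (_ : ∀ q ∈ V, q.Prime ∧ (q ∣ 2 * 3 * 5 * ℓ ∨ (∃ v ∈ badPlacesAvoid (Pt a c) {2, ℓ}, residueChar (Pt a c).F v = q) ∨
            ∃ u : HeightOneSpectrum (𝓞 K), residueChar K u = q ∧ 2 ≤ u.asIdeal.ramificationIdx ℤ))
          (_ : ∀ u : HeightOneSpectrum (𝓞 K), 2 ≤ u.asIdeal.ramificationIdx ℤ → residueChar K u ∈ V)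
          (_ : ∀ w ∈ (TateDivisorDatum.ofNFPointOver (Pt a c) {2, ℓ} F).V, residueChar F w ∈ V)
          (DK : Finset (HeightOneSpectrum (𝓞 K))) (_ : ∀ u, differentDivisor K (Sum.inr u) ≠ 0 → u ∈ DK)
          (vol : ℕ → ℝ) (volArch : ℝ),
          (∀ p ∈ V, -(1 / (((ℓ : ℝ) - 1) / 2)) * |vol p| ≤ ((ℓ : ℝ) + 1) / 4 *
            ((1 + 4 / (ℓ : ℝ)) *
                ((Module.finrank ℚ K : ℝ)⁻¹ *
                  ∑ u ∈ DK with residueChar K u = p, differentDivisor K (Sum.inr u) * logNorm K u)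
              - 1 / 6 *
                ((Module.finrank ℚ F : ℝ)⁻¹ *
                  ∑ w ∈ (TateDivisorDatum.ofNFPointOver (Pt a c) {2, ℓ} F).V with residueChar F w = p,
                    (TateDivisorDatum.ofNFPointOver (Pt a c) {2, ℓ} F).tateDivisor (Sum.inr w) * logNorm F w)
              + 4 / (ℓ : ℝ) * Real.log p
              + 20 / 3 * ((2 ^ 12 * 3 ^ 3 * 5 * eMod Lmod : ℕ) : ℝ) *
                (if p ≤ 2 ^ 12 * 3 ^ 3 * 5 * eMod Lmod * ℓ then Real.log p / p else 0))) ∧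
          -(1 / (2 * (ℓ : ℝ)) * (TateDivisorDatum.ofNFPointOver (Pt a c) {2, ℓ} F).logq) ≤
            -(1 / (((ℓ : ℝ) - 1) / 2)) * (∑ p ∈ V, |vol p| + |volArch|) := by
  subst hℓ5
  rintro ⟨F, _, _, _, K, _, _, _, _, _, _, ψ, hU, hF, hK, -, Lmod, _, _, -, hdmod, V, -, -, hbad, DK, -, vol, volArch,
    hStepV, hLower⟩
  have hc1 : 1 ≤ c := le_trans (by norm_num) hc
  have hℓ : (5 : ℕ).Prime := by norm_num
  -- `7 ∈ V^dst_ℚ`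
  obtain ⟨w₇, hw₇, hres₇⟩ := exists_mem_V_residueChar_eq_seven ha hc1 hℓ (by norm_num) F
  have h7V : 7 ∈ V := hres₇ ▸ hbad w₇ hw₇
  -- the three genuine numbers at `p₀ = 7`
  have hq7 := qSeven_eq ha hc1 hℓ (by norm_num) F
  have hd7 := dSeven_le ha hc1 ψ hU hF hℓ (by norm_num) hK DK
  have hQ : (TateDivisorDatum.ofNFPointOver (Pt a c) {2, 5} F).logq ≤ 2 * c * Real.log 7 := by
    rw [TateDivisorDatum.logq_ofNFPointOver_eq_logQAvoid, logQAvoid_two_five_eq ha hc1]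
  -- the Mertens coefficient `e*_mod ≤ 2·2¹²3³5` and weight `ι₇ ≤ (log 7)/7`
  have hE : (((2 ^ 12 * 3 ^ 3 * 5 * eMod Lmod : ℕ) : ℝ)) ≤ 1105920 := by
    have h := (eMod_le_dMod (Lmod := Lmod)).trans hdmod
    have : ((eMod Lmod : ℕ) : ℝ) ≤ 2 := by exact_mod_cast h
    push_cast; nlinarith
  have hι : ∀ N : ℕ, (0 : ℝ) ≤ (if 7 ≤ N then Real.log 7 / 7 else 0) ∧ (if 7 ≤ N then Real.log 7 / 7 else 0) ≤ Real.log 7 / 7 := by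
    intro N
    have : 0 ≤ Real.log 7 / 7 := div_nonneg (Real.log_nonneg (by norm_num)) (by norm_num)
    split_ifs <;> exact ⟨by positivity, by linarith⟩
  refine not_exists_volumes_of_localExcess 5 (by norm_num) V
    (fun p => (Module.finrank ℚ K : ℝ)⁻¹ * ∑ u ∈ DK with residueChar K u = p, differentDivisor K (Sum.inr u) * logNorm K u)
    (fun p => (Module.finrank ℚ F : ℝ)⁻¹ *
      ∑ w ∈ (TateDivisorDatum.ofNFPointOver (Pt a c) {2, 5} F).V with residueChar F w = p,
        (TateDivisorDatum.ofNFPointOver (Pt a c) {2, 5} F).tateDivisor (Sum.inr w) * logNorm F w)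
    ((2 ^ 12 * 3 ^ 3 * 5 * eMod Lmod : ℕ) : ℝ) _ (2 ^ 12 * 3 ^ 3 * 5 * eMod Lmod * 5) h7V ?_ ⟨vol, volArch, hStepV, hLower⟩
  have h7 : ((7 : ℕ) : ℝ) = 7 := by norm_num
  have h5 : ((5 : ℕ) : ℝ) = 5 := by norm_num
  simp only [h7, h5]
  exact localExcess_arith_five (by exact_mod_cast hc) hQ hq7.ge hd7 hE (hι _).1 (hι _).2

/-- **Every prime `ℓ ≥ 5` — the full range of `InitialThetaData.five_le_l` / `ATS3.InitialThetaData.five_le` — at `d = 2` on the S-unit family:**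
at `P_{a,c}` with `a ≥ 10⁸`, `c ≥ 10⁷`, `7^c ≤ 5^a`, the `∃`-body of p464392 §4 (VERBATIM, `d := 2`, `P := Pt a c`) is FALSE for EVERY prime `ℓ ≥ 5`:
`ℓ = 5` by `genuineResidualSupport_unsat_five` (`p₀ = 7`), `ℓ ≥ 7` by p480406's `genuineResidualSupport_unsat` (`p₀ = 5`). The (r4) right edge of
the Y-21 PARENT word thus reads «every admissible prime `ℓ`» under either reading of «admissible» (E5 binder: vacuous below `7`,
`not_itdConditions_five`; structures: `ℓ ≥ 5`, covered). A located COUNTERMODEL to the E5 residual AS PRINTED at OUR typed carriers — not to any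
author's theorem; NO side taken on [IUTchIII] Cor. 3.12 / [IUTchIV] Thm. 1.10; NOT an abc claim. [claim: Joshi2024ATS4, status: disputed] -/
theorem genuineResidualSupport_unsat_of_five_le {a c : ℕ} (ha : 10 ^ 8 ≤ a) (hc : 10 ^ 7 ≤ c) (hlo : 7 ^ c ≤ 5 ^ a) {ℓ : ℕ}
    (hℓ : ℓ.Prime) (h5 : 5 ≤ ℓ) :
    ¬ ∃ (F : Type) (_ : Field F) (_ : NumberField F) (_ : Algebra (Pt a c).F F)
          (K : Type) (_ : Field K) (_ : NumberField K) (_ : Algebra F K) (_ : Algebra (Pt a c).F K)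
          (_ : IsScalarTower (Pt a c).F F K)
          (_ : IsGalois F K) (ψ : K →ₐ[F] AlgebraicClosure F) (hU : (Pt a c).InU) (_ : IsThetaField (Pt a c) F)
          (_ : letI := thetaCurve_isElliptic hU F
            ((thetaCurve (Pt a c) F).galoisRepTorsion (ℓ : ℤ)).ker ≤ ψ.fieldRange.fixingSubgroup)
          (_ : 0 < (TateDivisorDatum.ofNFPointOver (Pt a c) {2, ℓ} F).logq)
          (Lmod : Type) (_ : Field Lmod) (_ : NumberField Lmod) (_ : Cor22.dmod (Pt a c) ≤ dMod Lmod) (_ : dMod Lmod ≤ 2)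
          (V : Finset ℕ)
          (_ : ∀ q ∈ V, q.Prime ∧ (q ∣ 2 * 3 * 5 * ℓ ∨ (∃ v ∈ badPlacesAvoid (Pt a c) {2, ℓ}, residueChar (Pt a c).F v = q) ∨
            ∃ u : HeightOneSpectrum (𝓞 K), residueChar K u = q ∧ 2 ≤ u.asIdeal.ramificationIdx ℤ))
          (_ : ∀ u : HeightOneSpectrum (𝓞 K), 2 ≤ u.asIdeal.ramificationIdx ℤ → residueChar K u ∈ V)
          (_ : ∀ w ∈ (TateDivisorDatum.ofNFPointOver (Pt a c) {2, ℓ} F).V, residueChar F w ∈ V)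
          (DK : Finset (HeightOneSpectrum (𝓞 K))) (_ : ∀ u, differentDivisor K (Sum.inr u) ≠ 0 → u ∈ DK)
          (vol : ℕ → ℝ) (volArch : ℝ),
          (∀ p ∈ V, -(1 / (((ℓ : ℝ) - 1) / 2)) * |vol p| ≤ ((ℓ : ℝ) + 1) / 4 *
            ((1 + 4 / (ℓ : ℝ)) *
                ((Module.finrank ℚ K : ℝ)⁻¹ *
                  ∑ u ∈ DK with residueChar K u = p, differentDivisor K (Sum.inr u) * logNorm K u)
              - 1 / 6 *
                ((Module.finrank ℚ F : ℝ)⁻¹ *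
                  ∑ w ∈ (TateDivisorDatum.ofNFPointOver (Pt a c) {2, ℓ} F).V with residueChar F w = p,
                    (TateDivisorDatum.ofNFPointOver (Pt a c) {2, ℓ} F).tateDivisor (Sum.inr w) * logNorm F w)
              + 4 / (ℓ : ℝ) * Real.log p
              + 20 / 3 * ((2 ^ 12 * 3 ^ 3 * 5 * eMod Lmod : ℕ) : ℝ) *
                (if p ≤ 2 ^ 12 * 3 ^ 3 * 5 * eMod Lmod * ℓ then Real.log p / p else 0))) ∧
          -(1 / (2 * (ℓ : ℝ)) * (TateDivisorDatum.ofNFPointOver (Pt a c) {2, ℓ} F).logq) ≤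
            -(1 / (((ℓ : ℝ) - 1) / 2)) * (∑ p ∈ V, |vol p| + |volArch|) := by
  rcases (show ℓ = 5 ∨ ℓ = 6 ∨ 7 ≤ ℓ by omega) with h | h | h
  · exact genuineResidualSupport_unsat_five (le_trans (by norm_num) ha) hc h
  · exact absurd hℓ (by rw [h]; norm_num)
  · exact genuineResidualSupport_unsat ha (le_trans (by norm_num) hc) hlo hℓ h

end SUnitResidual

/-! ## Reader's checks: the two `InitialThetaData` structures admit `ℓ = 5` by decl; the E5 binder does not -/

/-- [IUTchI] Def. 3.1 (c) «`l` is a prime number `≥ 5`»: the tree's structure carries exactly `5 ≤ l`. [claim: Mochizuki2012, status: disputed] -/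
example {F K Fbar : Type} [Field F] [NumberField F] [Field K] [NumberField K] [Algebra F K] [Field Fbar] [Algebra F Fbar]
    [Algebra K Fbar] {E : WeierstrassCurve F} [E.IsElliptic] {l : ℕ} {P : Literature.IUT.HodgeTheaters.BadPlacePredicates K}
    (D : Literature.IUT.HodgeTheaters.InitialThetaData F K Fbar E l P) : 5 ≤ l := D.five_le_l

/-- [J-III] §3.3 (11) «Let `ℓ ≥ 5` be a prime number»: Joshi's structure carries exactly `5 ≤ ℓ`. [claim: Joshi2024ATS3, status: disputed] -/
example {L L' Lbar : Type} [Field L] [NumberField L] [Field L'] [NumberField L'] [Algebra L L'] [Field Lbar] [Algebra L Lbar]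
    [Algebra L' Lbar] {C : WeierstrassCurve L} [C.IsElliptic] {ℓ : ℕ} (D : ATS3.InitialThetaData L L' Lbar C ℓ) : 5 ≤ ℓ := D.five_le

/-- … whereas the E5 binder's `ITDConditions` excludes `ℓ = 5` at every point. [claim: Joshi2024ATS4, status: disputed] -/
example (P : NFPoint) : ¬ ITDConditions P 5 := not_itdConditions_five P

end Summit.ABC.IUTFork.Joshi.ATS4

end
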